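import Mathlib.MeasureTheory.Measure.Hausdorff
import Mathlib.MeasureTheory.Constructions.BorelSpace.Complex
import Mathlib.LinearAlgebra.Complex.FiniteDimensional
import HarnessLib

/-!
# Hausdorff measure of sets covered by Lipschitz sections of bounded multiplicity

An elementary covering estimate used in the proof of Lelong's theorem on the locally finite
`𝓗^{2p}`-measure of complex analytic sets (`Literature/Geometry/Kaehler/HolomorphicChainFacts.lean`,
`Lelong1957_hausdorffMeasure_inter_lt_top`), where the regular part of an analytic set is covered
by countably many graphs of uniformly Lipschitz holomorphic sections of finitely many linear
projections, each projection having fibres of bounded cardinality on the analytic set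
(an analytic cover):

* `tsum_indicator_one_le_of_card_le` — if every finite set of indices `i` with `y ∈ D i` has at
  most `K` elements, then `Σ_i 𝟙_{D i}(y) ≤ K`;
* `hausdorffMeasure_iUnion_le_of_lipschitzOnWith` — **the counting lemma**: if `E i ⊆ s i '' D i`
  with `s i` `L`-Lipschitz on the measurable set `D i` (countably many `i`) and the `D i` have
  multiplicity `≤ K` in the above sense, then `μH[d] (⋃ E i) ≤ L ^ d · K · μH[d] (⋃ D i)`
  (subadditivity, `LipschitzOnWith.hausdorffMeasure_image_le`, and
  `Σ_i μH[d] (D i) = ∫ Σ_i 𝟙_{D i} dμH[d] ≤ K μH[d] (⋃ D i)` by Tonelli);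
* `card_le_of_pairwiseDisjoint_of_image` — the multiplicity hypothesis for `D i = ℓ '' E i` from
  pairwise disjointness of the `E i` and a bound `K` on the fibres of `ℓ` on `⋃ E i`;
* `hausdorffMeasure_lt_top_of_isBounded_of_eq_finrank`, `hausdorffMeasure_eq_zero_of_lt_of_lt_top` — in a
  finite-dimensional real normed space `μH[dim]` is finite on bounded sets (Mathlib's
  `isAddHaarMeasure_hausdorffMeasure`), and a set of finite `μH[d₁]`-measure is `μH[d₂]`-null for
  `d₁ < d₂`; `finrank_real_pi_complex` records `dim_ℝ ℂᵖ = 2p`.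

Theorems only (no definitions, no named facts); Mathlib-only imports.

## References

* H. Federer, *Geometric Measure Theory* (1969), 2.10.10–2.10.11 (Lipschitz images and
  Hausdorff measure), 2.10.25 [Federer1969].
* E. M. Chirka, *Complex Analytic Sets* (1989), §14.1 (the use made of it: Lelong's theorem)
  [Chirka1989].
-/

open scoped ENNReal NNReal
open MeasureTheory Set

namespace Literature.Geometry.GeometricMeasureTheory

/-! ### Multiplicity of a family of sets at a point -/

section Multiplicity

variable {Y : Type*}

/-- If every finite set of indices `i` with `y ∈ D i` has at most `K` elements, then the sum of the
indicator functions `Σ_i 𝟙_{D i}(y)` is at most `K` (the sum is the supremum of its finite partial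
sums). [folklore] -/
theorem tsum_indicator_one_le_of_card_le {ι : Type*} (D : ι → Set Y) (K : ℕ) (y : Y)
    (h : ∀ F : Finset ι, (∀ i ∈ F, y ∈ D i) → F.card ≤ K) :
    ∑' i, (D i).indicator (1 : Y → ℝ≥0∞) y ≤ K := by
  classical
  rw [ENNReal.tsum_eq_iSup_sum]
  refine iSup_le fun F => ?_
  calc ∑ i ∈ F, (D i).indicator (1 : Y → ℝ≥0∞) y
        = ∑ i ∈ F.filter (fun i => y ∈ D i), (1 : ℝ≥0∞) := by
          rw [Finset.sum_filter]
          refine Finset.sum_congr rfl fun i _ => ?_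
          by_cases hi : y ∈ D i
          · rw [indicator_of_mem hi, if_pos hi, Pi.one_apply]
          · rw [indicator_of_notMem hi, if_neg hi]
    _ = ((F.filter fun i => y ∈ D i).card : ℝ≥0∞) := by
          rw [Finset.sum_const, nsmul_eq_mul, mul_one]
    _ ≤ K := by
          exact_mod_cast h _ fun i hi => (Finset.mem_filter.1 hi).2

/-- **Multiplicity from fibre cardinality.** If the sets `E i` are pairwise disjoint and every
finite subset of `⋃ E i` on which `ℓ` is constant has at most `K` elements, then every finite set
of indices `i` with `y ∈ ℓ '' E i` has at most `K` elements: choosing `x_i ∈ E i` with `ℓ x_i = y`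
gives an injection into a fibre. [folklore] -/
theorem card_le_of_pairwiseDisjoint_of_image {X ι : Type*} (E : ι → Set X) (ℓ : X → Y) (K : ℕ)
    (hdisj : Pairwise fun i j => Disjoint (E i) (E j))
    (hfib : ∀ y, ∀ S : Finset X, (↑S ⊆ ⋃ i, E i) → (∀ x ∈ S, ℓ x = y) → S.card ≤ K)
    (y : Y) (F : Finset ι) (hF : ∀ i ∈ F, y ∈ ℓ '' E i) : F.card ≤ K := by
  classical
  rcases F.eq_empty_or_nonempty with rfl | hne
  · simp
  obtain ⟨i₀, hi₀⟩ := hne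
  obtain ⟨x₀, -, -⟩ := hF i₀ hi₀
  haveI : Nonempty X := ⟨x₀⟩
  -- choose preimages
  have hch : ∀ i ∈ F, ∃ x ∈ E i, ℓ x = y := fun i hi => by
    obtain ⟨x, hx, hxy⟩ := hF i hi
    exact ⟨x, hx, hxy⟩
  choose! x hxE hxy using hch
  have hinj : Set.InjOn x (F : Set ι) := by
    intro i hi j hj hij
    by_contra hne
    exact Set.disjoint_left.1 (hdisj hne) (hxE i hi) (hij ▸ hxE j hj)
  calc F.card = (F.image x).card := (Finset.card_image_of_injOn hinj).symm
    _ ≤ K := by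
        refine hfib y _ ?_ ?_
        · intro z hz
          obtain ⟨i, hi, rfl⟩ := Finset.mem_image.1 (Finset.mem_coe.1 hz)
          exact mem_iUnion.2 ⟨i, hxE i hi⟩
        · intro z hz
          obtain ⟨i, hi, rfl⟩ := Finset.mem_image.1 hz
          exact hxy i hi

end Multiplicity

/-! ### The counting lemma -/

section Counting

variable {X Y : Type*} [EMetricSpace X] [MeasurableSpace X] [BorelSpace X]
  [EMetricSpace Y] [MeasurableSpace Y] [BorelSpace Y]

/-- **Hausdorff measure of a set covered by Lipschitz sections of bounded multiplicity.** Let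
`E i ⊆ s i '' D i` (`i` in a countable index type) with `s i` `L`-Lipschitz on the measurable set
`D i ⊆ Y`, and suppose the family `D` has multiplicity at most `K` (every finite set of indices `i`
with `y ∈ D i` has `≤ K` elements). Then `μH[d] (⋃ E i) ≤ L ^ d · K · μH[d] (⋃ D i)`: by countable
subadditivity and `μH[d] (s i '' D i) ≤ L ^ d μH[d] (D i)`, and
`Σ_i μH[d] (D i) = ∫ Σ_i 𝟙_{D i} dμH[d] ≤ ∫_{⋃ D i} K dμH[d]`. [folklore] -/
theorem hausdorffMeasure_iUnion_le_of_lipschitzOnWith {ι : Type*} [Countable ι] {d : ℝ}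
    (hd : 0 ≤ d) {L : ℝ≥0} {K : ℕ} (E : ι → Set X) (D : ι → Set Y) (s : ι → Y → X)
    (hE : ∀ i, E i ⊆ s i '' D i) (hs : ∀ i, LipschitzOnWith L (s i) (D i))
    (hD : ∀ i, MeasurableSet (D i))
    (hK : ∀ y, ∀ F : Finset ι, (∀ i ∈ F, y ∈ D i) → F.card ≤ K) :
    μH[d] (⋃ i, E i) ≤ (L : ℝ≥0∞) ^ d * K * μH[d] (⋃ i, D i) := by
  calc μH[d] (⋃ i, E i) ≤ ∑' i, μH[d] (E i) := measure_iUnion_le _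
    _ ≤ ∑' i, (L : ℝ≥0∞) ^ d * μH[d] (D i) := ENNReal.tsum_le_tsum fun i =>
        (measure_mono (hE i)).trans ((hs i).hausdorffMeasure_image_le hd)
    _ = (L : ℝ≥0∞) ^ d * ∑' i, μH[d] (D i) := ENNReal.tsum_mul_left
    _ = (L : ℝ≥0∞) ^ d * ∑' i, ∫⁻ y, (D i).indicator 1 y ∂μH[d] := by
        congr 1
        exact tsum_congr fun i => (lintegral_indicator_one (hD i)).symm
    _ = (L : ℝ≥0∞) ^ d * ∫⁻ y, ∑' i, (D i).indicator 1 y ∂μH[d] := by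
        rw [lintegral_tsum fun i => (measurable_one.indicator (hD i)).aemeasurable]
    _ ≤ (L : ℝ≥0∞) ^ d * ∫⁻ y, (⋃ i, D i).indicator (fun _ => (K : ℝ≥0∞)) y ∂μH[d] := by
        gcongr with y
        by_cases hy : y ∈ ⋃ i, D i
        · rw [indicator_of_mem hy]
          exact tsum_indicator_one_le_of_card_le D K y (hK y)
        · rw [indicator_of_notMem hy]
          have h0 : ∀ i, (D i).indicator (1 : Y → ℝ≥0∞) y = 0 := fun i =>
            indicator_of_notMem (fun hi => hy (mem_iUnion.2 ⟨i, hi⟩)) _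
          simp [h0]
    _ = (L : ℝ≥0∞) ^ d * K * μH[d] (⋃ i, D i) := by
        rw [lintegral_indicator_const (MeasurableSet.iUnion hD), mul_assoc]

/-- The counting lemma with the multiplicity hypothesis in fibre form: `E i` pairwise disjoint,
`E i ⊆ s i '' (ℓ '' E i)` with `s i` `L`-Lipschitz on the measurable set `ℓ '' E i`, and every
finite subset of `⋃ E i` contained in a fibre of `ℓ` has at most `K` elements. Then
`μH[d] (⋃ E i) ≤ L ^ d · K · μH[d] (⋃ ℓ '' E i)`. [folklore] -/
theorem hausdorffMeasure_iUnion_le_of_lipschitzOnWith_of_fibre {ι : Type*} [Countable ι] {d : ℝ}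
    (hd : 0 ≤ d) {L : ℝ≥0} {K : ℕ} (E : ι → Set X) (ℓ : X → Y) (s : ι → Y → X)
    (hE : ∀ i, E i ⊆ s i '' (ℓ '' E i)) (hs : ∀ i, LipschitzOnWith L (s i) (ℓ '' E i))
    (hD : ∀ i, MeasurableSet (ℓ '' E i))
    (hdisj : Pairwise fun i j => Disjoint (E i) (E j))
    (hfib : ∀ y, ∀ S : Finset X, (↑S ⊆ ⋃ i, E i) → (∀ x ∈ S, ℓ x = y) → S.card ≤ K) :
    μH[d] (⋃ i, E i) ≤ (L : ℝ≥0∞) ^ d * K * μH[d] (⋃ i, ℓ '' E i) :=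
  hausdorffMeasure_iUnion_le_of_lipschitzOnWith hd E (fun i => ℓ '' E i) s hE hs hD
    (card_le_of_pairwiseDisjoint_of_image E ℓ K hdisj hfib)

end Counting

/-! ### Finiteness of `μH[dim]` on bounded sets; dimension drop -/

section Finite

variable {E : Type*} [NormedAddCommGroup E] [NormedSpace ℝ E] [FiniteDimensional ℝ E]
  [MeasurableSpace E] [BorelSpace E]

/-- In a finite-dimensional real normed space, the Hausdorff measure of the top dimension is
finite on bounded sets (it is an additive Haar measure, `isAddHaarMeasure_hausdorffMeasure`).
Version with the dimension as a separate natural number `n = dim_ℝ E`; for `μH[dim_ℝ E]` itself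
use Mathlib's `Bornology.IsBounded.measure_lt_top` directly. [cite: Federer1969, 2.10.35] -/
theorem hausdorffMeasure_lt_top_of_isBounded_of_eq_finrank {n : ℕ} (hn : n = Module.finrank ℝ E)
    {s : Set E}
    (hs : Bornology.IsBounded s) : (μH[n] : Measure E) s < ⊤ := by
  subst hn
  exact hs.measure_lt_top

omit [NormedSpace ℝ E] [FiniteDimensional ℝ E] in
/-- A set of finite `μH[d₁]`-measure is `μH[d₂]`-null for every `d₂ > d₁`.
[cite: Federer1969, 2.10.25] -/
theorem hausdorffMeasure_eq_zero_of_lt_of_lt_top {d₁ d₂ : ℝ} (h : d₁ < d₂) {s : Set E}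
    (hs : (μH[d₁] : Measure E) s < ⊤) : (μH[d₂] : Measure E) s = 0 :=
  (Measure.hausdorffMeasure_zero_or_top h s).resolve_right hs.ne

end Finite

/-- `dim_ℝ ℂᵖ = 2p` for the coordinate space `Fin p → ℂ`. [folklore] -/
theorem finrank_real_pi_complex (p : ℕ) : Module.finrank ℝ (Fin p → ℂ) = 2 * p := by
  rw [Module.finrank_pi_fintype ℝ (ι := Fin p) (M := fun _ => ℂ)]
  simp [Complex.finrank_real_complex, Finset.sum_const, mul_comm]

/-- In `ℂᵖ` (sup norm), `μH[2p]` is finite on bounded sets. [folklore] -/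
theorem hausdorffMeasure_pi_complex_lt_top_of_isBounded (p : ℕ) {s : Set (Fin p → ℂ)}
    (hs : Bornology.IsBounded s) : (μH[(2 * p : ℕ)] : Measure (Fin p → ℂ)) s < ⊤ :=
  hausdorffMeasure_lt_top_of_isBounded_of_eq_finrank (finrank_real_pi_complex p).symm hs

end Literature.Geometry.GeometricMeasureTheory
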